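import Summits.AnomalousDissipation.AnomalousDissipation.Theses.MarginalStabilityChain
import Summits.AnomalousDissipation.AnomalousDissipation.Theorems.MarginalStabilityChainChainRealisationReduction
import HarnessLib

/-!
# Crux `ChainRealisation` (stmt-AnomalousDissipation-14249) — round-2 ideator-4 checks

Kernel-checked companions of `Negative-notes/ideator4-round2.md` (crux-ideate round 2, ideator 4,
2026-08-16).  Nothing here is a line for the crux; §0 re-reads the two doors from the landed
reduction (p111632), §1 is the `⊤`-DICHOTOMY used in the memo's audit of door (a):
a member of `StrainedLayerLaw`'s solution class whose dissipation `D` fails to be integrable on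
some initial time interval `(0, T₀]` satisfies EVERY floor `K ≤ liminf_T T⁻¹ ∫₀ᵀ D` — so every
non-uniqueness ghost that could refute stmt-3007 (and thereby close this crux through
`chainRealisation_of_not_strainedLayerLaw`) must have LOCALLY FINITE space–time dissipation,
i.e. live in an `L²_t Ḣ¹_x` energy class, where uniqueness (= the physical KH trajectory) is the
expected theorem.  Conversely, for PROVERS of stmt-3007 the lemma is a free first line:
WLOG `∫⁻ t in Ioc 0 T, D t < ⊤` for every `T > 0`.
-/

noncomputable section

set_option linter.dupNamespace false

open Set Filter MeasureTheory
open scoped ENNReal Topology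

namespace Summit.AnomalousDissipation.AnomalousDissipation.Cruxes.ChainRealisation.Ideator4R2

open Summit.AnomalousDissipation.AnomalousDissipation.Theses.MarginalStabilityChain
open Summit.AnomalousDissipation.AnomalousDissipation.Theorems.ChainRealisation.Reduction

/-! ## §0 The two doors (re-read from the landed reduction, p111632) -/

/-- Door (a): a refutation of the single-layer law closes the crux. [folklore] -/
example (h : ¬ StrainedLayerLaw) : ChainRealisation := chainRealisation_of_not_strainedLayerLaw h

/-- Door (b'): the route target closes the crux. [folklore] -/
example (h : ChainThesis) : ChainRealisation := chainRealisation_of_chainThesis h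

/-- There is no third door. [folklore] -/
example : ChainRealisation ↔ (¬ StrainedLayerLaw ∨ ChainThesis) := chainRealisation_iff_not_or

/-! ## §1 The `⊤`-dichotomy for Cesàro dissipation floors -/

/-- **`⊤`-DICHOTOMY.** If the time-lintegral of an `ℝ≥0∞`-valued dissipation `D` over some initial
interval `(0, T₀]` is `⊤`, then all later Cesàro means `T⁻¹ ∫₀ᵀ D` are `⊤` and every bound
`K ≤ liminf_T T⁻¹∫₀ᵀ D` holds.  In `StrainedLayerLaw` (stmt-3007) the floor has exactly this shape
(`D t = ofReal (ν/L) * ∫⁻ x in Ioc 0 L, ∫⁻ y, ofReal |∇(u,v)|²`), so: (i) any member of the bare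
class with `∫⁻ t in Ioc 0 T₀, D t = ⊤` for some `T₀ > 0` — in particular every Tychonoff-type
non-uniqueness ghost, whose growth at `|y| → ∞` on an initial time interval makes the Dirichlet
integral infinite there — is on the TRUE side of the law; (ii) provers of stmt-3007 may assume
`∫⁻ t in Ioc 0 T, D t < ⊤` for all `T > 0` (locally finite space–time dissipation, an
`L²_loc([0,∞); Ḣ¹)`-type class for the perturbation `(u − U_B, v)`), which is the class in which
uniqueness should be proved — not the bare pointwise-far-field class. [folklore] -/
theorem floor_of_setLIntegral_eq_top {D : ℝ → ℝ≥0∞} {T₀ : ℝ} (hT₀ : 0 < T₀)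
    (htop : ∫⁻ t in Ioc 0 T₀, D t = ∞) (K : ℝ≥0∞) :
    K ≤ liminf (fun T : ℝ => ENNReal.ofReal T⁻¹ * ∫⁻ t in Ioc 0 T, D t) atTop := by
  have hev : ∀ᶠ T in atTop,
      (ENNReal.ofReal T⁻¹ * ∫⁻ t in Ioc 0 T, D t) = (fun _ : ℝ => (⊤ : ℝ≥0∞)) T := by
    filter_upwards [eventually_ge_atTop T₀] with T hT
    have hTpos : 0 < T := hT₀.trans_le hT
    have hmono : ∫⁻ t in Ioc 0 T₀, D t ≤ ∫⁻ t in Ioc 0 T, D t :=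
      lintegral_mono_set (Ioc_subset_Ioc_right hT)
    rw [htop] at hmono
    have hint : ∫⁻ t in Ioc 0 T, D t = ∞ := eq_top_iff.2 hmono
    have hne : ENNReal.ofReal T⁻¹ ≠ 0 := (ENNReal.ofReal_pos.2 (inv_pos.2 hTpos)).ne'
    rw [hint, ENNReal.mul_top hne]
  have hlim : liminf (fun T : ℝ => ENNReal.ofReal T⁻¹ * ∫⁻ t in Ioc 0 T, D t) atTop = ⊤ := by
    rw [liminf_congr hev]
    exact liminf_const ⊤
  rw [hlim]
  exact le_top

/-- The same dichotomy in "WLOG" form: to prove a Cesàro floor it suffices to prove it for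
dissipations that are locally integrable from `t = 0⁺`. [folklore] -/
theorem floor_wlog_locallyFinite {D : ℝ → ℝ≥0∞} (K : ℝ≥0∞)
    (h : (∀ T : ℝ, 0 < T → ∫⁻ t in Ioc 0 T, D t < ∞) →
      K ≤ liminf (fun T : ℝ => ENNReal.ofReal T⁻¹ * ∫⁻ t in Ioc 0 T, D t) atTop) :
    K ≤ liminf (fun T : ℝ => ENNReal.ofReal T⁻¹ * ∫⁻ t in Ioc 0 T, D t) atTop := by
  by_cases hfin : ∀ T : ℝ, 0 < T → ∫⁻ t in Ioc 0 T, D t < ∞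
  · exact h hfin
  · push Not at hfin
    obtain ⟨T₀, hT₀, htop⟩ := hfin
    exact floor_of_setLIntegral_eq_top hT₀ (top_unique htop) K

end Summit.AnomalousDissipation.AnomalousDissipation.Cruxes.ChainRealisation.Ideator4R2
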